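import Summits.BirchSwinnertonDyer.Rank1Residual.AdditivePotMult.QuadraticBaseChangeTamagawaMultiplicative
import Summits.BirchSwinnertonDyer.Rank1Residual.AdditivePotMult.QuadraticTwistRamifiedPotMult
import Literature.NumberTheory.EllipticCurves.QuadraticTwistJInvariantProofs
import Literature.NumberTheory.EllipticCurves.QuadraticTwistPadicReduction
import Literature.NumberTheory.EllipticCurves.TamagawaVariableChangeProofs
import Literature.NumberTheory.DiophantineGeometry.MinimalDiscriminantSmulProofs
import Literature.NumberTheory.DiophantineGeometry.LocalReductionProofs
import HarnessLib

/-!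
# `W ⊗ K ≅ Wd ⊗ K` when `d` is a square in `K`: the local data of `W ⊗ K` are those of `Wd ⊗ K`,
# and the scaling `u'` of a minimal `K`-model (row T-MIL-ODD, FILE A-4K; seat n1011-p01 GEN 5)

HONEST FRAMING (cell `b2b-bsdres`, run/shared/lean/b2b/bsd-rank1-residual/, verbatim in every
file): the goal of the cell is to DELETE the COMBINATION-SHAPED residual classes of the
Birch–Swinnerton-Dyer formula for ALL analytic-rank `≤ 1` elliptic curves over `ℚ` — "full BSD
formula for every rank `≤ 1` curve in class `C`" assembled STRICTLY from published theorems — so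
that the rank-`≤ 1` remainder becomes exactly the CONSTRUCTION-SHAPED classes, which are TYPED
(missing-input `Prop`s), NOT attempted. This is not "finishing BSD". Sub-classes X3♯(M) / X4(M)
(additive, potentially multiplicative prime; base-change-and-descend): a RESEARCH ROUTE; they stay
CONSTRUCTION-SHAPED; nothing is booked by this file; no mark / label moved. THEOREMS ONLY: no
definition, no named fact, no `sorry`.

## What and why (row T-MIL-ODD, `cells/n1011/skel/T-MIL-ODD.md`, §1 (A≥5)/(D), `K`-side)

In the odd part of Milne's quadratic BSD-quotient identity (`hWR` of `AdditivePotMult/Descent`,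
A65/A73; `hodd` of `bsdRHS_baseChange_quadratic_of_padicValRat`) the `K`-side terms are
`∏_w c_w(W')` and `|N(u')|` for a globally minimal `K`-model `W' = C' • W_K`. When `d = θ²` in `K`
(always for `K = ℚ(√d)`), `W ⊗ K` and `Wd ⊗ K` (`Cd • W^{(d)} = Wd`) are `K`-ISOMORPHIC, so every
local datum of `W ⊗ K` may be read on `Wd ⊗ K` — which at the potentially multiplicative ramified
prime is the base change of a MULTIPLICATIVE curve, handled by FILE A-1b:

* `exists_variableChange_baseChange_twist_eq` — `Wd ⊗ K = C • (W ⊗ K)` for an explicit `C`;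
* `localTamagawaNumber_baseChange_eq_of_twist`, `ordMinimalDiscriminant_baseChange_eq_of_twist`,
  `hasSplitMultiplicativeReductionAt_baseChange_iff_of_twist` — equal `c_𝔭`, `ord_𝔭 Δ_min`,
  splitness (tree invariance facts `localTamagawaNumber_variableChange_holds`,
  `ordMinimalDiscriminant_smul_holds`, `hasSplitMultiplicativeReductionAt_smul_iff_holds`);
* `valuation_u_pow_twelve_of_isMinimalAt` — for `W/ℚ` globally minimal, `𝔭 ∣ v` and ANY
  `K`-model `W' = C' • W_K` minimal at `𝔭`:
  `|C'.u|_𝔭¹² · |Δ_min(W ⊗ K)|_𝔭 = |Δ_min(W)|_v^{e(𝔭|v)}`, i.e.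
  `12·ord_𝔭(C'.u) = e·ord_v Δ_min(W) − ord_𝔭 Δ_min(W ⊗ K)`;
* `valuation_u_eq_exp_neg_ramificationIdx_half_of_mult_twist` — at the ramified prime of the
  X3♯(M)/X4(M) descent (`Wd` multiplicative at `v`, `ℓ ∥ d` odd): `ord_𝔭 Δ_min(W ⊗ K) = e·n`
  (A-1b on `Wd`) and `ord_v Δ_min(W) = n + 6` (A-4M), so **`2·ord_𝔭(C'.u) = e(𝔭|v)`** — for the
  ramified place of `ℚ(√d)` (`e = 2`): `ord_𝔭(C'.u) = 1`, the `K`-side `δ`-term `δ_w = 1`.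

HONEST LIMITS: TOOL theorems; closes no class, discharges no fact by itself (assembly = stage C);
nothing about any curve is asserted. References: Silverman *AEC* VII.1 Prop. 1.3, X.5 Cor. 5.4;
*ATAEC* Cor. IV.9.2 (d); Milne 1972 §1; Kramer 1981 §2.
-/

noncomputable section

open scoped Classical NumberField

open WeierstrassCurve NumberField IsDedekindDomain Rat.HeightOneSpectrum
  Literature.NumberTheory.EllipticCurves Literature.NumberTheory.EllipticCurves.Rank1Residual
  Literature.NumberTheory.GaloisRepresentations Field IsLocalRing
  Summit.BirchSwinnertonDyer.Rank1Residual.Additive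

namespace Summit.BirchSwinnertonDyer.Rank1Residual.AdditivePotMult

/-! ## §1 `Wd ⊗ K ≅ W ⊗ K` when `d` is a square in `K` -/

section Iso

variable (W Wd : WeierstrassCurve ℚ) {K : Type} [Field K] [NumberField K]

/-- **`Wd ⊗ K = C • (W ⊗ K)`** for `Cd • W^{(d)} = Wd` and `d = θ²` in `K` (`θ ≠ 0`): twisting
commutes with base change (`map_quadraticTwist`) and with changes of variables
(Mathlib `map_variableChange`), and `X^{(θ²)} ≅ X` over `K`
(`exists_variableChange_smul_eq_quadraticTwist_sq`). [cite: SilvermanAEC2009, X.5 Cor. 5.4] -/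
theorem exists_variableChange_baseChange_twist_eq {d : ℚ} {Cd : VariableChange ℚ}
    (hCd : Cd • W.quadraticTwist d = Wd) {θ : K} (hθ0 : θ ≠ 0) (hθ : θ ^ 2 = algebraMap ℚ K d) :
    ∃ C : VariableChange K, Wd.baseChange K = C • W.baseChange K := by
  obtain ⟨C₁, hC₁⟩ := (W.baseChange K).exists_variableChange_smul_eq_quadraticTwist_sq hθ0
  refine ⟨Cd.map (algebraMap ℚ K) * C₁, ?_⟩
  rw [mul_smul, hC₁, hθ, ← hCd, baseChange, baseChange, ← map_variableChange, map_quadraticTwist]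

variable (𝔭 : HeightOneSpectrum (𝓞 K))

/-- **Equal Tamagawa numbers: `c_𝔭(Wd ⊗ K) = c_𝔭(W ⊗ K)`** (`K`-isomorphic curves; tree
`localTamagawaNumber_variableChange_holds` at the completion).
[cite: SilvermanAEC2009, VII.1 Prop. 1.3(b)] -/
theorem localTamagawaNumber_baseChange_eq_of_twist [W.IsElliptic] {d : ℚ} {Cd : VariableChange ℚ}
    (hCd : Cd • W.quadraticTwist d = Wd) {θ : K} (hθ0 : θ ≠ 0) (hθ : θ ^ 2 = algebraMap ℚ K d) :
    ((Wd.baseChange K).baseChange (𝔭.adicCompletion K)).localTamagawaNumber (𝔭.adicCompletionIntegers K) =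
      ((W.baseChange K).baseChange (𝔭.adicCompletion K)).localTamagawaNumber
        (𝔭.adicCompletionIntegers K) := by
  obtain ⟨C, hC⟩ := exists_variableChange_baseChange_twist_eq W Wd hCd hθ0 hθ
  haveI : (W.baseChange K).IsElliptic := by rw [baseChange]; infer_instance
  haveI : ((W.baseChange K).baseChange (𝔭.adicCompletion K)).IsElliptic := by
    rw [baseChange]; infer_instance
  rw [hC, baseChange, ← map_variableChange]
  exact localTamagawaNumber_variableChange_holds (𝔭.adicCompletionIntegers K)
    ((W.baseChange K).map (algebraMap K (𝔭.adicCompletion K))) (C.map (algebraMap K _))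

/-- **Equal minimal discriminants: `ord_𝔭 Δ_min(Wd ⊗ K) = ord_𝔭 Δ_min(W ⊗ K)`.**
[cite: SilvermanAEC2009, VII.1 Prop. 1.3(b)] -/
theorem ordMinimalDiscriminant_baseChange_eq_of_twist [W.IsElliptic] {d : ℚ} {Cd : VariableChange ℚ}
    (hCd : Cd • W.quadraticTwist d = Wd) {θ : K} (hθ0 : θ ≠ 0) (hθ : θ ^ 2 = algebraMap ℚ K d) :
    (Wd.baseChange K).ordMinimalDiscriminant 𝔭 = (W.baseChange K).ordMinimalDiscriminant 𝔭 := by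
  obtain ⟨C, hC⟩ := exists_variableChange_baseChange_twist_eq W Wd hCd hθ0 hθ
  haveI : (W.baseChange K).IsElliptic := by rw [baseChange]; infer_instance
  rw [hC]
  exact ordMinimalDiscriminant_smul_holds 𝔭 (W.baseChange K) C

/-- **Equal splitness: `Wd ⊗ K` is split multiplicative at `𝔭` iff `W ⊗ K` is.**
[cite: SilvermanAEC2009, VII.5 Prop. 5.1(b) and VII.1 Prop. 1.3(b)] -/
theorem hasSplitMultiplicativeReductionAt_baseChange_iff_of_twist [W.IsElliptic] {d : ℚ}
    {Cd : VariableChange ℚ} (hCd : Cd • W.quadraticTwist d = Wd) {θ : K} (hθ0 : θ ≠ 0)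
    (hθ : θ ^ 2 = algebraMap ℚ K d) :
    (Wd.baseChange K).HasSplitMultiplicativeReductionAt 𝔭 ↔
      (W.baseChange K).HasSplitMultiplicativeReductionAt 𝔭 := by
  obtain ⟨C, hC⟩ := exists_variableChange_baseChange_twist_eq W Wd hCd hθ0 hθ
  haveI : (W.baseChange K).IsElliptic := by rw [baseChange]; infer_instance
  rw [hC]
  exact hasSplitMultiplicativeReductionAt_smul_iff_holds 𝔭 (W.baseChange K) C

/-- **Equal multiplicativity: `Wd ⊗ K` is multiplicative at `𝔭` iff `W ⊗ K` is.**
[cite: SilvermanAEC2009, VII.5 Prop. 5.1(b) and VII.1 Prop. 1.3(b)] -/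
theorem hasMultiplicativeReductionAt_baseChange_iff_of_twist [W.IsElliptic] {d : ℚ}
    {Cd : VariableChange ℚ} (hCd : Cd • W.quadraticTwist d = Wd) {θ : K} (hθ0 : θ ≠ 0)
    (hθ : θ ^ 2 = algebraMap ℚ K d) :
    (Wd.baseChange K).HasMultiplicativeReductionAt 𝔭 ↔
      (W.baseChange K).HasMultiplicativeReductionAt 𝔭 := by
  obtain ⟨C, hC⟩ := exists_variableChange_baseChange_twist_eq W Wd hCd hθ0 hθ
  haveI : (W.baseChange K).IsElliptic := by rw [baseChange]; infer_instance
  rw [hC]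
  exact hasMultiplicativeReductionAt_smul_iff_holds 𝔭 (W.baseChange K) C

end Iso

/-! ## §2 The scaling `u'` of a minimal `K`-model at `𝔭` -/

section Scaling

variable (W : WeierstrassCurve ℚ) [W.IsElliptic] [W.IsGloballyMinimal] {v : HeightOneSpectrum (𝓞 ℚ)}
  {K : Type} [Field K] [NumberField K] (𝔭 : HeightOneSpectrum (𝓞 K))

/-- **`|C'.u|_𝔭¹² · |Δ_min(W ⊗ K)|_𝔭 = |Δ_min(W)|_v^{e}`** — i.e.
`12·ord_𝔭(C'.u) = e(𝔭|v)·ord_v Δ_min(W) − ord_𝔭 Δ_min(W ⊗ K)` — for `W/ℚ` globally minimal, a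
place `𝔭 ∣ v` of a number field `K` and ANY `K`-model `W' = C' • W_K` minimal at `𝔭`:
`Δ(W') = C'.u⁻¹² Δ(W)` with `|Δ(W')|_𝔭 = |Δ_min(W ⊗ K)|_𝔭` (`W'` minimal; model independence
`ordMinimalDiscriminant_smul_holds`) and `|Δ(W)|_𝔭 = |Δ(W)|_v^e` (Mathlib `valuation_liesOver`).
This is the `K`-side `δ`-term `ord_𝔭(u')` of the odd part of Milne's identity.
[cite: SilvermanAEC2009, VII.1 Prop. 1.3(a) and Table 3.1] -/
theorem valuation_u_pow_twelve_of_isMinimalAt (h𝔭 : 𝔭.asIdeal.under (𝓞 ℚ) = v.asIdeal)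
    {W' : WeierstrassCurve K} {C' : VariableChange K} (hW' : C' • W.baseChange K = W')
    (hmin : W'.IsMinimalAt 𝔭) :
    𝔭.valuation K (C'.u : K) ^ 12 *
        WithZero.exp (-((W.baseChange K).ordMinimalDiscriminant 𝔭 : ℤ)) =
      WithZero.exp (-((v.asIdeal.ramificationIdx' 𝔭.asIdeal * W.ordMinimalDiscriminant v : ℕ) : ℤ)) := by
  haveI : (W.baseChange K).IsElliptic := by rw [baseChange]; infer_instance
  haveI : W'.IsElliptic := by rw [← hW']; infer_instance
  -- `|Δ(W')|_𝔭 = exp(-ord Δ_min(W ⊗ K))`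
  have hΔ' := valuation_Δ_eq_of_isMinimalAt_holds 𝔭 W' hmin
  have hord : W'.ordMinimalDiscriminant 𝔭 = (W.baseChange K).ordMinimalDiscriminant 𝔭 := by
    rw [← hW']; exact ordMinimalDiscriminant_smul_holds 𝔭 (W.baseChange K) C'
  -- `|Δ(W)|_v = exp(-ord Δ_min(W))` and `|Δ(W)|_𝔭 = |Δ(W)|_v ^ e`
  have hΔQ := valuation_Δ_eq_of_isMinimalAt_holds v W (IsGloballyMinimal.isMinimal v)
  haveI : 𝔭.asIdeal.LiesOver v.asIdeal := ⟨h𝔭.symm⟩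
  have hlies := IsDedekindDomain.HeightOneSpectrum.valuation_liesOver K v 𝔭 W.Δ
  rw [hΔQ, ← WithZero.exp_nsmul, Int.nsmul_eq_mul] at hlies
  -- `Δ(W') = u⁻¹² Δ(W ⊗ K)`
  have hΔ : W'.Δ = (↑C'.u⁻¹ : K) ^ 12 * algebraMap ℚ K W.Δ := by
    rw [← hW', variableChange_Δ, baseChange, map_Δ]
  have h := congrArg (𝔭.valuation K) hΔ
  rw [hΔ', hord, map_mul, map_pow, Units.val_inv_eq_inv_val, map_inv₀, ← hlies, inv_pow] at h
  have hu0 : 𝔭.valuation K (C'.u : K) ≠ 0 := (Valuation.ne_zero_iff _).mpr (Units.ne_zero _)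
  have h12 : 𝔭.valuation K (C'.u : K) ^ 12 ≠ 0 := pow_ne_zero _ hu0
  rw [eq_inv_mul_iff_mul_eq₀ h12] at h
  rw [h]
  push_cast
  ring_nf

end Scaling

/-! ## §3 The ramified prime of the X3♯(M)/X4(M) descent, `K`-side -/

section PotMultK

variable (W Wd : WeierstrassCurve ℚ) [W.IsElliptic] [W.IsGloballyMinimal] [Wd.IsElliptic]
  [Wd.IsGloballyMinimal] {v : HeightOneSpectrum (𝓞 ℚ)} {K : Type} [Field K] [NumberField K]
  (𝔭 : HeightOneSpectrum (𝓞 K))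

omit [W.IsGloballyMinimal] in
/-- **`ord_𝔭 Δ_min(W ⊗ K) = e(𝔭|v) · ord_v Δ_min(Wd)`** when `Cd • W^{(d)} = Wd` is MULTIPLICATIVE at
`v`, `d` a square in `K`, `𝔭 ∣ v`: `W ⊗ K ≅ Wd ⊗ K` (§1) and A-1b's
`ordMinimalDiscriminant_baseChange_eq_mul_of_hasMultiplicativeReductionAt` for `Wd`.
[cite: SilvermanAEC2009, VII.1 Prop. 1.3(b) and VII.5 Prop. 5.1(b)] -/
theorem ordMinimalDiscriminant_baseChange_eq_mul_of_mult_twist {d : ℚ} {Cd : VariableChange ℚ}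
    (hCd : Cd • W.quadraticTwist d = Wd) {θ : K} (hθ0 : θ ≠ 0) (hθ : θ ^ 2 = algebraMap ℚ K d)
    (hmult : Wd.HasMultiplicativeReductionAt v) (h𝔭 : 𝔭.asIdeal.under (𝓞 ℚ) = v.asIdeal) :
    (W.baseChange K).ordMinimalDiscriminant 𝔭 =
      v.asIdeal.ramificationIdx' 𝔭.asIdeal * Wd.ordMinimalDiscriminant v := by
  rw [← ordMinimalDiscriminant_baseChange_eq_of_twist W Wd 𝔭 hCd hθ0 hθ,
    ordMinimalDiscriminant_baseChange_eq_mul_of_hasMultiplicativeReductionAt Wd 𝔭 hmult h𝔭]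

/-- **`2·ord_𝔭(C'.u) = e(𝔭|v)` at the ramified prime of the X3♯(M)/X4(M) descent.** For `W`, `Wd`
globally minimal over `ℚ` with `Cd • W^{(d)} = Wd` (`d` an integer, `ℓ ∥ d`, `ℓ` odd), `Wd`
MULTIPLICATIVE at the place `v` over `ℓ`, `K` a number field containing `√d`, `𝔭 ∣ v`, and
`W' = C' • W_K` minimal at `𝔭`: `|C'.u|_𝔭¹² = |ℓ|... ` precisely
`𝔭.valuation K (C'.u) ^ 12 = exp(-(6·e))` — from §2 with `ord_v Δ_min(W) = n + 6` (FILE A-4M)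
and `ord_𝔭 Δ_min(W ⊗ K) = e·n`. For the ramified place of `ℚ(√d)` (`e = 2`) this is
`ord_𝔭(C'.u) = 1` (next theorem). [cite: SilvermanAEC2009, VII.1 Prop. 1.3] -/
theorem valuation_u_pow_twelve_of_mult_twist (hv2 : (primesEquiv v : ℕ) ≠ 2) {d : ℤ}
    (h1 : ((primesEquiv v : ℕ) : ℤ) ∣ d) (h2 : ¬ ((primesEquiv v : ℕ) : ℤ) ^ 2 ∣ d)
    {Cd : VariableChange ℚ} (hCd : Cd • W.quadraticTwist (d : ℚ) = Wd)
    (hmult : Wd.HasMultiplicativeReductionAt v) {θ : K} (hθ0 : θ ≠ 0)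
    (hθ : θ ^ 2 = algebraMap ℚ K (d : ℚ)) (h𝔭 : 𝔭.asIdeal.under (𝓞 ℚ) = v.asIdeal)
    {W' : WeierstrassCurve K} {C' : VariableChange K} (hW' : C' • W.baseChange K = W')
    (hmin : W'.IsMinimalAt 𝔭) :
    𝔭.valuation K (C'.u : K) ^ 12 =
      WithZero.exp (-((6 * v.asIdeal.ramificationIdx' 𝔭.asIdeal : ℕ) : ℤ)) := by
  have h := valuation_u_pow_twelve_of_isMinimalAt W 𝔭 h𝔭 hW' hmin
  obtain ⟨-, hord⟩ :=
    hasAdditiveReductionAt_and_ordMinimalDiscriminant_of_mult_twist W Wd v hv2 h1 h2 hCd hmult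
  rw [ordMinimalDiscriminant_baseChange_eq_mul_of_mult_twist W Wd 𝔭 hCd hθ0 hθ hmult h𝔭, hord] at h
  have hu0 : 𝔭.valuation K (C'.u : K) ≠ 0 := (Valuation.ne_zero_iff _).mpr (Units.ne_zero _)
  obtain ⟨m, hm⟩ : ∃ m : ℤ, 𝔭.valuation K (C'.u : K) = WithZero.exp m :=
    ⟨WithZero.log (𝔭.valuation K (C'.u : K)), (WithZero.exp_log hu0).symm⟩
  rw [hm, ← WithZero.exp_nsmul, ← WithZero.exp_add, WithZero.exp_inj] at h
  rw [hm, ← WithZero.exp_nsmul, WithZero.exp_inj]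
  simp only [nsmul_eq_mul, Nat.cast_ofNat] at h ⊢
  push_cast at h ⊢
  nlinarith [h]

/-- **`ord_𝔭(C'.u) = 1` at a place with `e(𝔭|v) = 2`** (the ramified place of `ℚ(√d)` above
`ℓ ∥ d`): the `K`-side `δ`-term `δ_w = 1` of (L_ℓ)@p at the potentially multiplicative ramified
prime (skeleton §1 (D): `δ_w = δ_d`, both `= 1` here — FILE A-4M gives `ord_v(Cd.u) = 1`).
[cite: SilvermanAEC2009, VII.1 Prop. 1.3] -/
theorem valuation_u_eq_exp_neg_one_of_mult_twist_of_ramificationIdx_eq_two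
    (hv2 : (primesEquiv v : ℕ) ≠ 2) {d : ℤ}
    (h1 : ((primesEquiv v : ℕ) : ℤ) ∣ d) (h2 : ¬ ((primesEquiv v : ℕ) : ℤ) ^ 2 ∣ d)
    {Cd : VariableChange ℚ} (hCd : Cd • W.quadraticTwist (d : ℚ) = Wd)
    (hmult : Wd.HasMultiplicativeReductionAt v) {θ : K} (hθ0 : θ ≠ 0)
    (hθ : θ ^ 2 = algebraMap ℚ K (d : ℚ)) (h𝔭 : 𝔭.asIdeal.under (𝓞 ℚ) = v.asIdeal)
    (he : v.asIdeal.ramificationIdx' 𝔭.asIdeal = 2)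
    {W' : WeierstrassCurve K} {C' : VariableChange K} (hW' : C' • W.baseChange K = W')
    (hmin : W'.IsMinimalAt 𝔭) :
    𝔭.valuation K (C'.u : K) = WithZero.exp (-1 : ℤ) := by
  have h := valuation_u_pow_twelve_of_mult_twist W Wd 𝔭 hv2 h1 h2 hCd hmult hθ0 hθ h𝔭 hW' hmin
  rw [he] at h
  have hu0 : 𝔭.valuation K (C'.u : K) ≠ 0 := (Valuation.ne_zero_iff _).mpr (Units.ne_zero _)
  obtain ⟨m, hm⟩ : ∃ m : ℤ, 𝔭.valuation K (C'.u : K) = WithZero.exp m :=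
    ⟨WithZero.log (𝔭.valuation K (C'.u : K)), (WithZero.exp_log hu0).symm⟩
  rw [hm, ← WithZero.exp_nsmul, WithZero.exp_inj] at h
  rw [hm, WithZero.exp_inj]
  simp only [nsmul_eq_mul, Nat.cast_ofNat] at h
  push_cast at h
  omega

end PotMultK

end Summit.BirchSwinnertonDyer.Rank1Residual.AdditivePotMult

end
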